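import Literature.MathematicalPhysics.QuantumFieldTheory.Balaban1983to89.B8Thm2TorusUniqPerB9
import Literature.MathematicalPhysics.QuantumFieldTheory.Balaban1983to89.B8Thm2TorusAtOfLetters

/-!
# `Balaban1983to89.B8Thm2TorusAtOfLettersPerB9` — [Balaban1985RegularSpaces] Theorem 2 (p. 83) ON THE TORUS `T_η`, BOTH HALVES, FOR A
# `G`-VALUED PAIR (`G ≤ U(𝔸)` averaging-closed with a trace-like `τ`; `G = SU(N)`, `N ≤ 25`): the interface of record
# `B8Thm2TorusAt.Thm2TorusAt L k P η 0 B₁ B₂ c₁ len G (fun _ => True)` SUPPLIED, member-uniformly, MODULO THE v3 [4] LETTERS `LettersAllPer` AND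
# NOTHING ELSE — the v3-b9 endpoint of sub-row «G-B8-T2S»: `B8Thm2TorusAtOfLettersPer` WITHOUT the `ℤᵈ`-wide b9 socket `∀ m ≤ k, SockB9P3 … m {ℤᵈ} …`

statement-level skeleton of published theorems with citation tags; proofs where landed; nothing here is a claim about the
Yang–Mills mass gap

T. Bałaban, *Spaces of regular gauge field configurations on a lattice and gauge fixing conditions*, Commun. Math. Phys. **99** (1985)
75–102 `[Balaban1985RegularSpaces]` ("B8"): Thm 2 p. 83 with (1.33)–(1.39) pp. 82–83, Thm 4 p. 88, Prop. 5 p. 94, p. 95, (1.42) p. 83, (1.59)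
p. 86 («Theorem 3.3 of [4] implies the bounds …»), (1.65)–(1.66) p. 87, p. 77 («Ω_j = T_η»), p. 76 (`G = SU(N)`), §3 p. 98 (the torus reading); T. Bałaban,
*Propagators for lattice gauge theories in a background field*, Commun. Math. Phys. **99** (1985) 389–434 `[Balaban1985BackgroundPropagators]` ("[4]"):
Thms 3.1–3.3 pp. 397–399 (the letters and the in-edge (1.59), proved on the FINITE torus `T_η` — hence laws at periodic arguments ∕ for periodic fields).
STATUS: published, refereed.

CITATION HEADER (lean-in-tree rule).  Cell `lit-balaban`, seat `lit-balaban-t2s-1` (gen 3), sub-row «G-B8-T2S» (R3 `stmt-QuantumFields-19200`,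
`--supports`), route P layer L4 (v3-b9 endpoint; SCOPE NOTE «B9-SCOPE» 2026-08-28).  WHAT IS REPRODUCED.  `B8Thm2TorusAtOfLettersPer` (the v3 endpoint
`thm2TorusAt_specialUnitary_of_lettersPer`, p612721) VERBATIM except that its hypothesis «`∀ m ≤ k, SockB9P3 L B₀ B₀β c_{b9} β len η m {ℤᵈ} torusLam
torusLamb`» — [4] Thm 3.3 ⇒ (1.59) in Proposition 3's frame asserted for ALL unitary pairs on `ℤᵈ`, periodic or not, which no torus theorem supplies — is
GONE: the three places of the proof that read it (the (1.69)-regeneration inside the Prop-5 ∃λ-body, the same inside the uniqueness body, the (1.59) socket)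
read it AT ONE PERIODIC DATUM, where the v3 letters' own law (B) `LettersAtPer.b9P3` ([4] Thm 3.3 at the bundle's `U₀` for PERIODIC `W`, `A′`) serves
(`B8Thm2TorusB9Per` = G1: `grad_bound_of_lines`, `sockHFPτ_family_of_lettersAtPerB9`, `sockP5Step_of_lettersAtPerB9`, `sock159_of_lettersAtPer`;
`B8Thm2TorusUniqPerB9` = G2: `sockP5Uniq_of_lettersAtPerB9`).  Accordingly the letters' b9 constant `B₀` IS Theorem 2's `B₀` and their threshold is the
`c_{b9}` of the windows (one name `cB9` below), and §1 takes the letters at EVERY truncation `1 ≤ n ≤ k` (`ℓu`; the bundle `LettersAllPer` has them):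
* §1 ★ **`thm2TorusSockets_of_lettersAtPerB9`** — `Thm2TorusSockets L k P η 0 B₀ (2B₀) (8B₀′·5dLB₀) c_u B₁ len G α₀ α₁ U₀ U′` at explicit windows from
  `ℓ : LettersAtPer … k α₀ P U₀`, `LettersPerTau τ ℓ` and `ℓu n : LettersAtPer … n α₀ P U₀` (`1 ≤ n ≤ k`);
* §2 ★ **`thm2TorusSockets_uniform_of_lettersPerB9`**, ★ **`thm2TorusAt_uniform_of_lettersPerB9`** — ONE `c_u, c₀` resp. ONE `B₂, c₁` (from `d, L`, the
  letters' constants, `B₁`; NOT from `k, P, η`) and `Thm2TorusAt L k P η 0 B₁ B₂ c₁ len G (fun _ => True)` at every torus member carrying `LettersAllPer`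
  with its `τ`-laws — NO further socket;
* §3 ★ **`thm2TorusSockets_specialUnitary_of_lettersPerB9`**, ★ **`thm2TorusAt_specialUnitary_of_lettersPerB9`** — `G = SU(N)`, `1 ≤ N ≤ 25`,
  `𝔸 = M_N(ℂ)`, `τ = tr`, `H = SL(N, ℂ)`: THE v3-b9 ENDPOINT, the shape consumed by `B8Thm2SetupTorus.thm2SetupSUAt_of_thm2TorusAt` (`N = 2` on R3).

## HONEST SCOPE
(i) Compositions of landed engines; Proposition 5, (1.42), (1.59) and [4] are NOT re-proved here.  REMAINING HYPOTHESES, displayed: the v3 [4] letters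
`LettersAllPer L B_G B_R B₀′ᴴ B₂′ B₀ B₀β c_{b9} β len c_L η k P G` (Green's functions `G′`, `H′`, `C⁻¹`, … at every `G`-valued `P`-periodic background of the
class, identity laws at PERIODIC arguments, bounds, and the in-edge law (B) = [4] Thm 3.3 for PERIODIC fields — what [4] Thms 3.1–3.3 give on `T_η`;
sub-row «G-B9-LETTERS», no supplier in tree yet), their `τ`-laws `LettersAllPerTau`, the free-constant condition `3·(2dL²)·B_G·(B_R + 2) ≤ B₀′`, `5dLB₀ ≥ 2`,
`B₁ > 5dLB₀(1 + 11d²)`, `c_{b9} > 0`, `P ∈ Lᵏℤ`, `d, L ≥ 2`.  (ii) Hölder datum `β₀ = 0` (`B₂(0)`).  (iii) Count-neutral: N05 ∕ `stub_PV3A` is NOT discharged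
by this file (its consumer still owes the letters); Theorem 2 on `T_η` is a theorem MODULO THE LETTERS; nothing continuum ∕ ℝ⁴ ∕ OS ∕ mass-gap ∕ Clay —
the Yang–Mills mass gap is NOT proved.  No `sorry`, no `def`, no `… : Prop` fact, no `instance`, no `notation`.
-/

noncomputable section

open NormedSpace
open scoped BigOperators

namespace Literature.MathematicalPhysics.QuantumFieldTheory.Balaban1983to89.B8Thm2TorusAtOfLettersPerB9

open Complex (I)
open MatrixLog (mlog)
open B7Prop1Explicit B7Prop2Explicit B7Prop1Local B7Eq92Concrete
open B7Prop2Explicit (C0 c2')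
open B7Prop3Flat (c3)
open B7Prop10General (C6 C4G)
open B7Prop9Flat (C5')
open B8Ineq132 (InAk)
open B8Eq119TwistedAxial (InAx)
open B8Eq184Proof (gaugeExp cfgExp)
open B8Lemma1NonAbelian (mulCfg)
open B8Ineq125Concrete (C2p)
open B8Prop5ContractionKLevel (Mc Kc)
open B8Eq133Hypotheses (Hyp135)
open B12Ineq417Flat (shiftCfg)
open B8Thm4TorusAt (torusLam)
open B8Thm2TorusMember (torusLamb)
open B8Thm2TorusAt (Thm2TorusAt)
open B8Thm2TorusLettersPer (LettersAtPer LettersPerTau LettersAllPer LettersAllPerTau)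
open B8Thm2TorusSupplier (Thm2TorusSockets Thm2TorusWindows alpha1e cstarT alpha4T guardT apply_add_of_shiftCfg norm_sub_one_le_torus
  thm2TorusAt_of_sockets thm2TorusWindows_threshold)
open B8Thm2TorusSock142159 (inAx_torusLam_all h135_allLevels sock142_of135 sock142_top)
open B8Thm2TorusB9Per (sockP5Step_of_lettersAtPerB9 sock159_of_lettersAtPer)
open B8Thm2TorusServerPer (sockP5Base_of_lettersAtPer)
open B8Thm2TorusUniqPerB9 (sockP5Uniq_of_lettersAtPerB9)
open B8Thm2TorusAtOfLetters (serverWindows_threshold)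
open B8SockHFPWindows (hfpWindows_of_guard)
open B8SockP5uEWindows (uniqWindows_of_guard)
open B8Thm4TruncationLocal (base_datum)

-- `Site` alone could resolve to the torus sites of `Setup.lean`; re-export the `ℤ^d` sites of `B7Prop1Explicit`.
export B7Prop1Explicit (Site)

variable {d : ℕ}

/-! ## §1 The six sockets at one pair, explicit windows, from the v3 letters alone -/

section Pair

variable {𝔸 : Type*} [CStarAlgebra 𝔸] [Nontrivial 𝔸]
variable (τ : 𝔸 →L[ℂ] ℂ)

/-- ★ **ALL SIX SOCKETS OF THEOREM 2 ON THE TORUS AT ONE `G`-VALUED `P`-PERIODIC PAIR, FROM THE v3 LETTERS AT `U₀`** (explicit windows):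
`B8Thm2TorusSupplier.Thm2TorusSockets L k P η 0 B₀ (2B₀) (8B₀′·5dLB₀) c_u B₁ len G α₀ α₁ U₀ U′` for `G ≤ U(𝔸)` averaging-closed inside `H` with the
`τ`-laws (J-SU data), a pair `U₀, U′` in Theorem 2's regime (1.33)–(1.35) at `k ≥ 1` levels on `T_η` (`P ∈ Lᵏℤ`), GIVEN the v3 [4] letters `ℓ : LettersAtPer
… k α₀ P U₀` (laws at periodic arguments) with `LettersPerTau τ ℓ`, the letters `ℓu n` at every truncation `1 ≤ n ≤ k` (b9 law (B)), and the windows: Theorem 2's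
`Thm2TorusWindows`, the JOIN family (at `B_R + 2`) below `cP₁` and the uniqueness family (instance `2B₀`, at `B_R + 2`, radius `α₄ᵘ`, domain `c_u`) below
`cP₂`, evaluated at `(α₀, α₁ᵉ)` (`α₁ᵉ = 11d²α₀ + α₁`, Theorem 4 run at the renamed `α₁` of (1.66), p. 88) and at `(α₀, α₁′)` with
`5dLB₀(α₀ + α₁′) = B₁(α₀ + α₁)`.  Conjuncts: Prop. 5 base (p. 89; the (1.36) exponent of `U′` from (1.65)) and step (p. 94) by `B8Thm2TorusServerPer`
(periodicity of the gauge by construction), (1.42) at the levels `m < k` and at the top, (1.59) with `β₀ = 0` (`B8Thm2TorusSock142159`), and (1.109) at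
`c_A = B₁(α₀ + α₁)` by `B8Thm2TorusUniqPer`.
[cite: Balaban1985RegularSpaces, Thm 2 p.83, (1.33)–(1.36) p.82, Thm 4 p.88, (1.65)–(1.66) p.87, Prop. 5 (1.106)–(1.109) p.94, p.95, (1.42) p.83, (1.59) p.86, §3 p.98; Balaban1985BackgroundPropagators, Thms 3.1–3.3 pp.397–399] -/
theorem thm2TorusSockets_of_lettersAtPerB9 (hτ : ∀ x y : 𝔸, τ (x * y) = τ (y * x)) (hd2 : 2 ≤ d) {L : ℕ} (hL : 2 ≤ L) {η : ℝ} (hη : 0 < η)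
    {k : ℕ} (hk : 1 ≤ k) {P : ℤ} (hP : ∃ M : ℤ, P = (L : ℤ) ^ k * M)
    {G H : Subgroup 𝔸ˣ} (hGrp2 : ∀ g ∈ H, ‖(g : 𝔸) - 1‖ ≤ 1 / 8 → τ (mlog (g : 𝔸)) = 0) (hGrp3 : ∀ S : 𝔸, τ S = 0 → expUnit S ∈ H)
    (hGA : AvgClosed d L G) (hGH : G ≤ H) (hGu : G ≤ unitaryUnits 𝔸)
    (hG3 : ∀ (lam : Site d → 𝔸) (x : Site d), IsSelfAdjoint (lam x) → τ (lam x) = 0 → gaugeExp lam x ∈ G)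
    {α₀ α₁ α₁' B₀ B₀' B₀'H B₂' BG BR B₀β cB9 β cu α₄u B₁ cP₁ cP₂ : ℝ} {len : Site d → ℝ}
    (hα₀ : 0 < α₀) (hα₁ : 0 < α₁) (hB₀ : 0 < B₀) (hB₀' : 0 < B₀') (hB₀'H : 0 < B₀'H) (hB₂' : 0 ≤ B₂') (hBG : 0 ≤ BG) (hBR : 0 ≤ BR)
    (hα₄u : 0 < α₄u)
    (hW : Thm2TorusWindows d L B₀ (8 * B₀' * (5 * (d : ℝ) * L * B₀)) cu B₁ α₀ α₁)
    (hg9 : guardT d L B₀ (8 * B₀' * (5 * (d : ℝ) * L * B₀)) α₀ α₁ ≤ cB9)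
    (hα₁'eq : 5 * (d : ℝ) * L * B₀ * (α₀ + α₁') = B₁ * (α₀ + α₁)) (hα₁'e : alpha1e d α₀ α₁ ≤ α₁')
    (h₁ : α₀ + alpha1e d α₀ α₁ ≤ cP₁) (h₂ : α₀ + α₁' ≤ cP₂)
    (hfpF : ∀ α₀ α₁ : ℝ, 0 < α₀ → 0 < α₁ → α₀ + α₁ ≤ cP₁ →
      ∀ cs α₄ cB cDA hE hE₂ lE lE₂ : ℝ, cs = 5 * (d : ℝ) * L * B₀ * (α₀ + α₁) → α₄ = 8 * B₀' * (5 * (d : ℝ) * L * B₀) * (α₀ + α₁) →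
      cB = L * cs → cDA = 2 * (d : ℝ) * (L : ℝ) ^ 2 * cs →
      hE = B₀'H * (C2p d * (40 * d * cB + α₄) * α₄) → hE₂ = B₂' * (C2p d * (40 * d * cB + α₄) * α₄) →
      lE = B₀'H * (4 * C2p d * (40 * d * cB + 2 * α₄)) → lE₂ = B₂' * (4 * C2p d * (40 * d * cB + 2 * α₄)) →
      36 * d * B₀ * cs ≤ 1 / 2 ∧
      8 * (131072 * ((d : ℝ) + 1) ^ 2) * Real.exp (4 * (800 * ((d : ℝ) + 1) ^ 2 * ((d : ℝ) + 4)) * α₀) ≤ 16 * (131072 * ((d : ℝ) + 1) ^ 2) ∧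
      2 * cs ^ 2 + 20 * d * α₀ * cs + 2 * (16 * (131072 * ((d : ℝ) + 1) ^ 2)) * cs ^ 2 ≤ α₀ + α₁ ∧
      (d : ℝ) * L * α₁ ≤ 1 / 8 ∧
      α₀ ≤ cB9 ∧ cs ≤ cB9 ∧
      C0 d * α₀ ≤ 1 / 3 ∧ 4 * α₀ ≤ c2' d L ∧
      Real.exp (4 * (800 * ((d : ℝ) + 1) ^ 2 * ((d : ℝ) + 4)) * α₀) * (1 + 8 * (131072 * ((d : ℝ) + 1) ^ 2) * cB) ≤ 2 ∧
      2 * cB ≤ c3 d L ∧ 2048 * (d : ℝ) * cB ≤ 1 ∧ 40 * d * cB ≤ 1 / 200 ∧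
      200 * C6 d * (2 * α₄) ≤ 1 ∧ 12000 * ((d : ℝ) + 1) * L * (2 * α₄) ≤ 1 ∧
      C4G d L * (α₀ + 40 * d * cB + 4 * (2 * α₄)) ≤ 1 ∧
      1024 * ((d : ℝ) + 1) * ((d : ℝ) + 4) * L ^ 2 * α₀ ≤ 1 ∧ 32 * ((d : ℝ) + 1) ^ 2 * C6 d * L ^ 2 * α₀ ≤ 1 ∧
      16 * d * C5' d * C6 d * (L : ℝ) ^ 2 * α₀ ≤ 1 ∧ 8 * d * C6 d * L * α₀ ≤ 1 ∧
      40 * d * cB + α₄ ≤ 1 / (4 * B₀'H * (2 * C2p d)) ∧ 2 * C6 d * (40 * d * cB + 4 * α₄) ≤ 1 / 8 ∧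
      cB ≤ 1 / 13 ∧ α₄ / 4 + hE ≤ 1 / 24 ∧ α₄ / 4 + hE ≤ 1 / 140 ∧ 10 * (α₄ / 4 + hE) * (BR + 2) ≤ 1 / 2 ∧
      BG * Mc d (BR + 2) (α₄ / 4 + hE) cB hE₂ cDA ≤ α₄ / 4 ∧
      BG * Kc d (BR + 2) (α₄ / 4 + hE) cB hE₂ cDA lE₂ (1 + lE) (1 + lE) ≤ 1 / 2)
    (huF : ∀ α₀ α₁ : ℝ, 0 < α₀ → 0 < α₁ → α₀ + α₁ ≤ cP₂ →
      ∀ cs cB cDA hE hE₂ lE lE₂ : ℝ, cs = 5 * (d : ℝ) * L * (2 * B₀) * (α₀ + α₁) → cB = L * cs → cDA = (d : ℝ) * (L : ℝ) ^ 2 * cs →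
      hE = B₀'H * (C2p d * (40 * d * cB + α₄u) * α₄u) → hE₂ = B₂' * (C2p d * (40 * d * cB + α₄u) * α₄u) →
      lE = B₀'H * (4 * C2p d * (40 * d * cB + 2 * α₄u)) → lE₂ = B₂' * (4 * C2p d * (40 * d * cB + 2 * α₄u)) →
      36 * d * (2 * B₀) * cs ≤ 1 / 2 ∧
      8 * (131072 * ((d : ℝ) + 1) ^ 2) * Real.exp (4 * (800 * ((d : ℝ) + 1) ^ 2 * ((d : ℝ) + 4)) * α₀) ≤ 16 * (131072 * ((d : ℝ) + 1) ^ 2) ∧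
      2 * cs ^ 2 + 20 * d * α₀ * cs + 2 * (16 * (131072 * ((d : ℝ) + 1) ^ 2)) * cs ^ 2 ≤ α₀ + α₁ ∧
      (d : ℝ) * L * α₁ ≤ 1 / 8 ∧
      α₀ ≤ cB9 ∧ cs ≤ cB9 ∧
      C0 d * α₀ ≤ 1 / 3 ∧ 4 * α₀ ≤ c2' d L ∧
      Real.exp (4 * (800 * ((d : ℝ) + 1) ^ 2 * ((d : ℝ) + 4)) * α₀) * (1 + 8 * (131072 * ((d : ℝ) + 1) ^ 2) * cB) ≤ 2 ∧
      2 * cB ≤ c3 d L ∧ 2048 * (d : ℝ) * cB ≤ 1 ∧ 40 * d * cB ≤ 1 / 200 ∧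
      200 * C6 d * (2 * α₄u) ≤ 1 ∧ 12000 * ((d : ℝ) + 1) * L * (2 * α₄u) ≤ 1 ∧
      C4G d L * (α₀ + 40 * d * cB + 4 * (2 * α₄u)) ≤ 1 ∧
      1024 * ((d : ℝ) + 1) * ((d : ℝ) + 4) * L ^ 2 * α₀ ≤ 1 ∧ 32 * ((d : ℝ) + 1) ^ 2 * C6 d * L ^ 2 * α₀ ≤ 1 ∧
      16 * d * C5' d * C6 d * (L : ℝ) ^ 2 * α₀ ≤ 1 ∧ 8 * d * C6 d * L * α₀ ≤ 1 ∧
      40 * d * cB + α₄u ≤ 1 / (4 * B₀'H * (2 * C2p d)) ∧ 2 * C6 d * (40 * d * cB + 4 * α₄u) ≤ 1 / 8 ∧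
      cB ≤ 1 / 13 ∧ α₄u / 4 + hE ≤ 1 / 24 ∧ α₄u / 4 + hE ≤ 1 / 140 ∧ 10 * (α₄u / 4 + hE) * (BR + 2) ≤ 1 / 2 ∧
      BG * Mc d (BR + 2) (α₄u / 4 + hE) cB hE₂ cDA ≤ α₄u / 4 ∧
      BG * Kc d (BR + 2) (α₄u / 4 + hE) cB hE₂ cDA lE₂ (1 + lE) (1 + lE) ≤ 1 / 2 ∧
      lE ≤ 1 / 2 ∧ cu + hE ≤ α₄u / 4)
    {U₀ U' : Site d → Fin d → 𝔸ˣ} (hU₀G : ∀ x κ, U₀ x κ ∈ G) (hU'G : ∀ x κ, U' x κ ∈ G)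
    (hU₀P : ∀ i : Fin d, shiftCfg (P • e i) U₀ = U₀) (hU'P : ∀ i : Fin d, shiftCfg (P • e i) U' = U')
    (h33 : InAk L k η α₀ (fun _ => (Set.univ : Set (Site d))) U₀)
    (h34 : InAk L k η α₀ (fun _ => (Set.univ : Set (Site d))) (U' * U₀))
    (hAx : InAx L k (torusLam k) U₀ (U' * U₀)) (h35 : Hyp135 L k (torusLam k) α₁ U₀ U')
    (ℓ : LettersAtPer (𝔸 := 𝔸) L BG BR B₀'H B₂' B₀ B₀β cB9 β len η k α₀ P U₀) (ℓτ : LettersPerTau (𝔸 := 𝔸) τ ℓ)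
    -- the v3 letters at EVERY truncation `1 ≤ n ≤ k` (their b9 law (B) is read at `n = m` by the step server and the (1.59) socket)
    (ℓu : ∀ n, 1 ≤ n → n ≤ k → LettersAtPer (𝔸 := 𝔸) L BG BR B₀'H B₂' B₀ B₀β cB9 β len η n α₀ P U₀) :
    Thm2TorusSockets L k P η 0 B₀ (2 * B₀) (8 * B₀' * (5 * (d : ℝ) * L * B₀)) cu B₁ len G α₀ α₁ U₀ U' := by
  have hL1 : 1 ≤ L := le_trans (by norm_num) hL
  have hd1 : 1 ≤ d := le_trans (by norm_num) hd2
  have hLpos : 0 < L := by omega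
  have hdpos : 0 < d := by omega
  have hU₀ : ∀ x κ, U₀ x κ ∈ unitaryUnits 𝔸 := fun x κ => hGu (hU₀G x κ)
  have hU' : ∀ x κ, U' x κ ∈ unitaryUnits 𝔸 := fun x κ => hGu (hU'G x κ)
  have hU₀p : ∀ (x : Site d) (i : Fin d), U₀ (x + P • e i) = U₀ x := fun x i => funext fun κ => apply_add_of_shiftCfg hU₀P x i κ
  have hU'p : ∀ (x : Site d) (i : Fin d), U' (x + P • e i) = U' x := fun x i => funext fun κ => apply_add_of_shiftCfg hU'P x i κ
  have hα₁e0 : 0 < alpha1e d α₀ α₁ := by unfold alpha1e; positivity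
  have hα₁le : α₁ ≤ alpha1e d α₀ α₁ := by
    have : 0 ≤ 11 * (d : ℝ) ^ 2 * α₀ := by positivity
    unfold alpha1e; linarith
  have hα₁'0 : 0 < α₁' := lt_of_lt_of_le hα₁e0 hα₁'e
  have hα2 : 2 * α₀ ≤ c2' d L := by linarith [hW.c2]
  have hg0 : 0 < guardT d L B₀ (8 * B₀' * (5 * (d : ℝ) * L * B₀)) α₀ α₁ := by unfold guardT cstarT alpha4T; positivity
  -- Theorem 4's data at every level `≤ k` and the all-levels closeness (1.66) `≤ α₁ᵉ`
  have hAx' : ∀ m', m' ≤ k → InAx L m' (torusLam (d := d) m') U₀ (mulCfg U' U₀) := inAx_torusLam_all hL1 hAx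
  have h135all : ∀ j, j ≤ k → ∀ (z : Site d) (μ : Fin d),
      ‖(avgIter L (mulCfg U' U₀) j z μ : 𝔸) - (avgIter L U₀ j z μ : 𝔸)‖ ≤ alpha1e d α₀ α₁ :=
    h135_allLevels hd1 hL k hU₀ hU' hα₀ hW.c0 hα2 hα₁ hW.a6 h33 h34 hAx h35
  -- the window families at `(α₀, α₁ᵉ)` and `(α₀, α₁′)`
  have hwin := hfpF α₀ (alpha1e d α₀ α₁) hα₀ hα₁e0 h₁
  have huw' := huF α₀ α₁' hα₀ hα₁'0 h₂
  obtain ⟨-, -, -, hsmall₁, -⟩ := hwin _ _ _ _ _ _ _ _ rfl rfl rfl rfl rfl rfl rfl rfl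
  have hsmall₁' : (d : ℝ) * L * α₁ ≤ 1 / 8 := (mul_le_mul_of_nonneg_left hα₁le (by positivity)).trans hsmall₁
  -- the (1.36) exponent `A₀ = (iη)⁻¹ log U′` of `U′` at the base: `|U′ − 1| ≤ α₁ᵉ ≤ ⅙` by (1.65), `|A₀| ≤ 2α₁ᵉη⁻¹ ≤ c⋆η⁻¹`
  have hdat : ∀ (x : Site d) (κ : Fin d),
      U' x κ = cfgExp η (fun y μ => η⁻¹ • ((I⁻¹ : ℂ) • mlog ((U' y μ : 𝔸ˣ) : 𝔸))) x κ ∧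
        IsSelfAdjoint (η⁻¹ • ((I⁻¹ : ℂ) • mlog ((U' x κ : 𝔸ˣ) : 𝔸))) ∧
        ‖η⁻¹ • ((I⁻¹ : ℂ) • mlog ((U' x κ : 𝔸ˣ) : 𝔸))‖ ≤
          (5 * (d : ℝ) * L * B₀ * (α₀ + alpha1e d α₀ α₁)) * ((L : ℝ) ^ 0 * η)⁻¹ := by
    intro x κ
    have hb : ‖((U' x κ : 𝔸ˣ) : 𝔸) - 1‖ ≤ alpha1e d α₀ α₁ :=
      norm_sub_one_le_torus hd1 hL k hU₀ hU' hα₀ hW.c0 hα2 hα₁.le hW.a6 h33 h34 hAx h35 x κ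
    obtain ⟨-, h1, h2, h3⟩ := base_datum hη U₀ U' hU' (a := alpha1e d α₀ α₁) (by linarith [hW.a6]) x κ hb
    refine ⟨h1, h2, h3.trans ?_⟩
    have ha2 : 2 * alpha1e d α₀ α₁ ≤ 5 * (d : ℝ) * L * B₀ * (α₀ + alpha1e d α₀ α₁) := by
      have h := hW.a2; unfold cstarT at h; exact h
    rw [pow_zero, one_mul]
    exact mul_le_mul_of_nonneg_right ha2 (inv_nonneg.2 hη.le)
  -- the six sockets
  have hS1 := sockP5Base_of_lettersAtPer τ hτ hd2 hL hη hk hGrp2 hGrp3 hGA hGH hGu hG3 hα₀ hα₁e0 hB₀ hB₀' hB₀'H hB₂' hBG hBR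
    hU₀G hU'G h33 h34 hAx' hP hU₀p hU'p ℓ ℓτ hwin hdat
  have hS2 := sockP5Step_of_lettersAtPerB9 τ hτ hd2 hL hη hGrp2 hGrp3 hGA hGH hGu hG3 hα₀ hα₁e0 hB₀ hB₀' hB₀'H hB₂' hBG hBR
    hU₀G hU'G h33 h34 hAx' (fun j hj z μ _ => h135all j hj z μ) hP hU₀p hU'p ℓ ℓτ ℓu hwin
  have hS3 := sock142_of135 (P := P) hd2 hη hL k hGu hU₀G hU'G hα₀ hα₁ hg0.le hW.c0 hW.c2 hW.g16 hW.gexp hW.gc3 hW.a6 hsmall₁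
    h33 h34 hAx h35
  have hS4 := sock142_top (P := P) hd2 hη hL hk hGu hU₀G hα₀ hα₁ hg0.le hW.c0 hW.c2 hW.g16 hW.gexp hW.gc3 hsmall₁' h33 hAx h35
  have hS6 := sockP5Uniq_of_lettersAtPerB9 hd2 hL hη hk hP hGu hα₀ hα₁'0 hB₀ hα₄u hU₀G hU'G hU₀p hU'p h33 h34 hAx'
    (fun j hj z μ _ => (h135all j hj z μ).trans hα₁'e) hB₀'H hB₂' hBG hBR ℓ huw'
  rw [hα₁'eq] at hS6
  unfold Thm2TorusSockets
  exact ⟨hS1, hS2, fun m hm1 hmk => hS3 m hm1 hmk.le, hS4,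
    fun m hm1 hmk => sock159_of_lettersAtPer hd2 hη hL hGu hU₀G hU'G hg0 hg9 hW.g16 hB₀.le h33 h34 hU₀p hU'p hmk (ℓu m hm1 hmk), hS6⟩

end Pair

/-! ## §2 The member-uniform servers: the six sockets, and `Thm2TorusAt … G (fun _ => True)`, from the v3 letters -/

section Uniform

variable {𝔸 : Type*} [CStarAlgebra 𝔸] [Nontrivial 𝔸]
variable (τ : 𝔸 →L[ℂ] ℂ)

/-- ★ **THE SIX SOCKETS OF THEOREM 2 ON THE TORUS, MEMBER-UNIFORMLY, FROM THE v3 LETTERS** (the consumer's shape (a)): for `d, L ≥ 2`, `G ≤ U(𝔸)`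
averaging-closed inside `H` with the `τ`-laws, the letters' constants with `5dLB₀ ≥ 2`, `3·(2dL²)·B_G·(B_R + 2) ≤ B₀′` and `B₁ ≥ 5dLB₀(1 + 11d²)` there are
`c_u, c₀ > 0` — depending on these data only, NOT on `k`, `P`, `η` — such that (i) Theorem 2's windows `Thm2TorusWindows d L B₀ (8B₀′·5dLB₀) c_u B₁` hold
below `c₀`, and (ii) at every torus member (`k ≥ 1`, `P ∈ Lᵏℤ`, `η > 0`) carrying the v3 letters `LettersAllPer … cL η k P G` with their `τ`-laws (and
NOTHING ELSE), for all `α₀, α₁ > 0` with `α₀ + α₁ ≤ c₀` and every `G`-valued `P`-periodic pair in the regime (1.33)–(1.35):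
`Thm2TorusSockets L k P η 0 B₀ (2B₀) (8B₀′·5dLB₀) c_u B₁ len G α₀ α₁ U₀ U′`.
[cite: Balaban1985RegularSpaces, Thm 2 p.83, p.83 («B₁, B₂(β₀) … absolute constants depending on d and L only»), p.95, Prop. 5 p.94, (1.42) p.83, (1.59) p.86, §3 p.98; Balaban1985BackgroundPropagators, Thms 3.1–3.3 pp.397–399] -/
theorem thm2TorusSockets_uniform_of_lettersPerB9 (hτ : ∀ x y : 𝔸, τ (x * y) = τ (y * x)) (hd2 : 2 ≤ d) {L : ℕ} (hL : 2 ≤ L)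
    {G H : Subgroup 𝔸ˣ} (hGrp2 : ∀ g ∈ H, ‖(g : 𝔸) - 1‖ ≤ 1 / 8 → τ (mlog (g : 𝔸)) = 0) (hGrp3 : ∀ S : 𝔸, τ S = 0 → expUnit S ∈ H)
    (hGA : AvgClosed d L G) (hGH : G ≤ H) (hGu : G ≤ unitaryUnits 𝔸)
    (hG3 : ∀ (lam : Site d → 𝔸) (x : Site d), IsSelfAdjoint (lam x) → τ (lam x) = 0 → gaugeExp lam x ∈ G)
    {B₀ B₀' B₀'H B₂' BG BR B₀β cB9 β cL B₁ : ℝ} {len : Site d → ℝ}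
    (hB₀ : 0 < B₀) (hB₀' : 0 < B₀') (hB : 2 ≤ 5 * (d : ℝ) * L * B₀) (hB₀'H : 0 < B₀'H) (hB₂' : 0 ≤ B₂') (hBG : 0 ≤ BG) (hBR : 0 ≤ BR)
    (hcB9 : 0 < cB9) (hcL : 0 < cL) (hfree : 3 * (2 * (d : ℝ) * (L : ℝ) ^ 2) * BG * (BR + 2) ≤ B₀')
    (hB₁ : 5 * (d : ℝ) * L * B₀ * (1 + 11 * (d : ℝ) ^ 2) ≤ B₁) :
    ∃ cu c₀ : ℝ, 0 < cu ∧ 0 < c₀ ∧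
      (∀ ⦃α₀ α₁ : ℝ⦄, 0 < α₀ → 0 < α₁ → α₀ + α₁ ≤ c₀ → Thm2TorusWindows d L B₀ (8 * B₀' * (5 * (d : ℝ) * L * B₀)) cu B₁ α₀ α₁) ∧
      ∀ (k : ℕ) (P : ℤ) (η : ℝ), 1 ≤ k → 0 < η → (∃ M : ℤ, P = (L : ℤ) ^ k * M) →
      ∀ ℓP : LettersAllPer (𝔸 := 𝔸) L BG BR B₀'H B₂' B₀ B₀β cB9 β len cL η k P G, LettersAllPerTau (𝔸 := 𝔸) τ ℓP →
      ∀ ⦃α₀ α₁ : ℝ⦄, 0 < α₀ → 0 < α₁ → α₀ + α₁ ≤ c₀ → ∀ U₀ U' : Site d → Fin d → 𝔸ˣ,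
        (∀ x κ, U₀ x κ ∈ G) → (∀ x κ, U' x κ ∈ G) →
        (∀ i : Fin d, shiftCfg (P • e i) U₀ = U₀) → (∀ i : Fin d, shiftCfg (P • e i) U' = U') →
        InAk L k η α₀ (fun _ => (Set.univ : Set (Site d))) U₀ → InAk L k η α₀ (fun _ => (Set.univ : Set (Site d))) (U' * U₀) →
        InAx L k (torusLam k) U₀ (U' * U₀) → Hyp135 L k (torusLam k) α₁ U₀ U' →
        Thm2TorusSockets L k P η 0 B₀ (2 * B₀) (8 * B₀' * (5 * (d : ℝ) * L * B₀)) cu B₁ len G α₀ α₁ U₀ U' := by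
  have hL1 : 1 ≤ L := le_trans (by norm_num) hL
  have hd1 : 1 ≤ d := le_trans (by norm_num) hd2
  have hLpos : 0 < L := by omega
  have hdpos : 0 < d := by omega
  have h5 : 0 < 5 * (d : ℝ) * L * B₀ := by positivity
  have hB₁0 : 0 ≤ B₁ := le_trans (by positivity) hB₁
  have hBR2 : (0 : ℝ) ≤ BR + 2 := by linarith
  -- the window families (remainder constant `B_R + 2`) and Theorem 2's windows, then the one threshold
  obtain ⟨cP₁, hcP₁, hfpF⟩ := hfpWindows_of_guard hd1 hL1 hB₀ hB₀' hB hB₀'H hB₂' hBG hBR2 hcB9 hfree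
  have hB2 : 2 ≤ 5 * (d : ℝ) * L * (2 * B₀) := by linarith
  obtain ⟨α₄u, cu, cP₂, hα₄u, hcu, hcP₂, huF⟩ :=
    uniqWindows_of_guard hd1 hL1 (B₀ := 2 * B₀) (by positivity) hB2 hB₀'H hB₂' hBG hBR2 hcB9
  obtain ⟨cw, hcw, hWF⟩ :=
    thm2TorusWindows_threshold hd1 hL1 hB (B₄ := 8 * B₀' * (5 * (d : ℝ) * L * B₀)) (by positivity) hcu hB₁0
  obtain ⟨c₀, hc₀, hT⟩ := serverWindows_threshold hd1 hL1 hB₀ hB₀' hB₁0 hcB9 hcL hcP₁ hcP₂ hcu hcw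
  refine ⟨cu, c₀, hcu, hc₀, fun α₀ α₁ hα₀ hα₁ hc => hWF hα₀ hα₁ (hT α₀ α₁ hα₀ hα₁ hc).1, ?_⟩
  intro k P η hk hη hP ℓP ℓPτ α₀ α₁ hα₀ hα₁ hc U₀ U' hU₀G hU'G hU₀P hU'P h33 h34 hAx h35
  obtain ⟨hcw', hcL', -, -, hg9, h₁, -, h₃⟩ := hT α₀ α₁ hα₀ hα₁ hc
  have hU₀p : ∀ (x : Site d) (i : Fin d), U₀ (x + P • e i) = U₀ x := fun x i => funext fun κ => apply_add_of_shiftCfg hU₀P x i κ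
  -- the v3 letters at `U₀`, truncation `k` (all truncations `n ≤ k` inside the bundle), and the `τ`-laws
  have ℓτ : LettersPerTau (𝔸 := 𝔸) τ (ℓP k le_rfl hα₀ hcL' U₀ hU₀G hU₀p h33) := ℓPτ k le_rfl α₀ hα₀ hcL' U₀ hU₀G hU₀p h33
  -- Theorem 2's constant in the uniqueness socket: `5dLB₀(α₀ + α₁′) = B₁(α₀ + α₁)`, `α₁ᵉ ≤ α₁′` («B₁ not too small», p. 89)
  obtain ⟨α₁', hα₁'⟩ : ∃ α₁' : ℝ, α₁' = B₁ * (α₀ + α₁) / (5 * (d : ℝ) * L * B₀) - α₀ := ⟨_, rfl⟩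
  have hsum' : α₀ + α₁' = B₁ * (α₀ + α₁) / (5 * (d : ℝ) * L * B₀) := by rw [hα₁']; ring
  have hα₁'eq : 5 * (d : ℝ) * L * B₀ * (α₀ + α₁') = B₁ * (α₀ + α₁) := by
    rw [hsum']; field_simp
  have hα₁'e : alpha1e d α₀ α₁ ≤ α₁' := by
    have hE : α₀ + alpha1e d α₀ α₁ ≤ (1 + 11 * (d : ℝ) ^ 2) * (α₀ + α₁) := by
      have : 0 ≤ (d : ℝ) ^ 2 * α₁ := by positivity
      unfold alpha1e; linarith
    have h1 : 5 * (d : ℝ) * L * B₀ * (α₀ + alpha1e d α₀ α₁) ≤ 5 * (d : ℝ) * L * B₀ * (α₀ + α₁') := by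
      rw [hα₁'eq]
      calc 5 * (d : ℝ) * L * B₀ * (α₀ + alpha1e d α₀ α₁) ≤ 5 * (d : ℝ) * L * B₀ * ((1 + 11 * (d : ℝ) ^ 2) * (α₀ + α₁)) :=
            mul_le_mul_of_nonneg_left hE h5.le
        _ = 5 * (d : ℝ) * L * B₀ * (1 + 11 * (d : ℝ) ^ 2) * (α₀ + α₁) := by ring
        _ ≤ B₁ * (α₀ + α₁) := mul_le_mul_of_nonneg_right hB₁ (by linarith)
    have h2 := le_of_mul_le_mul_left h1 h5
    linarith
  have h₃' : α₀ + α₁' ≤ cP₂ := by rw [hsum']; exact h₃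
  exact thm2TorusSockets_of_lettersAtPerB9 τ hτ hd2 hL hη hk hP hGrp2 hGrp3 hGA hGH hGu hG3 hα₀ hα₁ hB₀ hB₀' hB₀'H hB₂' hBG hBR hα₄u
    (hWF hα₀ hα₁ hcw') hg9 hα₁'eq hα₁'e h₁ h₃' hfpF huF hU₀G hU'G hU₀P hU'P h33 h34 hAx h35
    (ℓP k le_rfl hα₀ hcL' U₀ hU₀G hU₀p h33) ℓτ (fun n _ hn => ℓP n hn hα₀ hcL' U₀ hU₀G hU₀p fun j hj => h33 j (hj.trans hn))

/-- ★ **THEOREM 2 ON THE TORUS, BOTH HALVES, MEMBER-UNIFORMLY, MODULO THE v3 LETTERS — `B8Thm2TorusAt.Thm2TorusAt L k P η 0 B₁ B₂ c₁ len G (fun _ =>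
True)` SUPPLIED**: under the hypotheses of `thm2TorusSockets_uniform_of_lettersPerB9` with `B₁ > 5dLB₀(1 + 11d²)` there is ONE pair `B₂, c₁ > 0`
(`B₂ = 5dL(2B₀)(1 + 11d²) + 1`; from `d, L`, the letters' constants and `B₁` only — p. 83 «absolute constants depending on d and L only») such that at
every torus member (`k ≥ 1`, `P ∈ Lᵏℤ`, `η > 0`) carrying the v3 letters and their `τ`-laws (no further socket): for `α₀, α₁ > 0` with
`α₀ + α₁ ≤ c₁` and `G`-valued `P`-periodic `U₀`, `U′` with (1.33)–(1.35) there is EXACTLY ONE `G`-valued `P`-periodic `u` with (1.29) and (1.36)–(1.39) for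
`U′^{u⁻¹} = e^{iηA}` (`B8Thm2TorusSupplier.thm2TorusAt_of_sockets` fed by `thm2TorusSockets_uniform_of_lettersPerB9`).  HONEST SCOPE: Theorem 2 on `T_η`
MODULO THE v3 [4] LETTERS (displayed hypotheses; laws at periodic arguments only), `β₀ = 0`; N05 ∕ `stub_PV3A` NOT discharged; nothing continuum ∕
mass-gap ∕ Clay. [cite: Balaban1985RegularSpaces, Thm 2 p.83, (1.33)–(1.39) pp.82–83, Thm 4 p.88, Prop. 5 p.94, p.95, p.77 («Ω_j = T_η»), §3 p.98; Balaban1985BackgroundPropagators, Thms 3.1–3.3 pp.397–399] -/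
theorem thm2TorusAt_uniform_of_lettersPerB9 (hτ : ∀ x y : 𝔸, τ (x * y) = τ (y * x)) (hd2 : 2 ≤ d) {L : ℕ} (hL : 2 ≤ L)
    {G H : Subgroup 𝔸ˣ} (hGrp2 : ∀ g ∈ H, ‖(g : 𝔸) - 1‖ ≤ 1 / 8 → τ (mlog (g : 𝔸)) = 0) (hGrp3 : ∀ S : 𝔸, τ S = 0 → expUnit S ∈ H)
    (hGA : AvgClosed d L G) (hGH : G ≤ H) (hGu : G ≤ unitaryUnits 𝔸)
    (hG3 : ∀ (lam : Site d → 𝔸) (x : Site d), IsSelfAdjoint (lam x) → τ (lam x) = 0 → gaugeExp lam x ∈ G)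
    {B₀ B₀' B₀'H B₂' BG BR B₀β cB9 β cL B₁ : ℝ} {len : Site d → ℝ}
    (hB₀ : 0 < B₀) (hB₀' : 0 < B₀') (hB : 2 ≤ 5 * (d : ℝ) * L * B₀) (hB₀'H : 0 < B₀'H) (hB₂' : 0 ≤ B₂') (hBG : 0 ≤ BG) (hBR : 0 ≤ BR)
    (hcB9 : 0 < cB9) (hcL : 0 < cL) (hfree : 3 * (2 * (d : ℝ) * (L : ℝ) ^ 2) * BG * (BR + 2) ≤ B₀')
    (hB₁ : 5 * (d : ℝ) * L * B₀ * (1 + 11 * (d : ℝ) ^ 2) < B₁) :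
    ∃ B₂ c₁ : ℝ, 0 < B₂ ∧ 0 < c₁ ∧ ∀ (k : ℕ) (P : ℤ) (η : ℝ), 1 ≤ k → 0 < η → (∃ M : ℤ, P = (L : ℤ) ^ k * M) →
      ∀ ℓP : LettersAllPer (𝔸 := 𝔸) L BG BR B₀'H B₂' B₀ B₀β cB9 β len cL η k P G, LettersAllPerTau (𝔸 := 𝔸) τ ℓP →
      Thm2TorusAt L k P η 0 B₁ B₂ c₁ len G (fun _ => True) := by
  have hLpos : 0 < L := by omega
  have hdpos : 0 < d := by omega
  obtain ⟨cu, c₀, hcu, hc₀, hW, hS⟩ := thm2TorusSockets_uniform_of_lettersPerB9 τ hτ hd2 hL hGrp2 hGrp3 hGA hGH hGu hG3 hB₀ hB₀' hB hB₀'H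
    hB₂' hBG hBR hcB9 hcL hfree hB₁.le
  refine ⟨5 * (d : ℝ) * L * (2 * B₀) * (1 + 11 * (d : ℝ) ^ 2) + 1, c₀, by positivity, hc₀, fun k P η hk hη hP ℓP ℓPτ => ?_⟩
  exact thm2TorusAt_of_sockets hd2 hη hL hk P hGu hB₀.le (by positivity) (by positivity) hB₁ (lt_add_one _) hW
    (fun α₀ α₁ hα₀ hα₁ hc U₀ U' hU₀ hU' hU₀P hU'P h33 h34 hAx h35 =>
      hS k P η hk hη hP ℓP ℓPτ hα₀ hα₁ hc U₀ U' hU₀ hU' hU₀P hU'P h33 h34 hAx h35)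

end Uniform

/-! ## §3 `G = SU(N)`, `𝔸 = M_N(ℂ)`, `τ = tr` — the v3 endpoint -/

section SpecialUnitary

open scoped Matrix.Norms.L2Operator
open B7Prop2SpecialUnitary (specialUnitaryUnits specialUnitaryUnits_le_unitaryUnits)
open B13Inv214OrbitSUN (slUnits)
open B8SpecialUnitaryTrace (trCLM trCLM_mul_comm expUnit_I_smul_mem_specialUnitaryUnits)
open B8SpecialLinearTrace (specialUnitaryUnits_le_slUnits trCLM_mlog_eq_zero_of_mem_slUnits expUnit_mem_slUnits)
open B7AvgClosedSpecialUnitarySharp (avgClosed_specialUnitary_of_le)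

variable {N : ℕ} [NeZero N]

/-- ★ **THE SIX SOCKETS OF THEOREM 2 ON THE TORUS FOR `G = SU(N)`, `1 ≤ N ≤ 25`, MEMBER-UNIFORMLY, FROM THE v3 LETTERS** —
`thm2TorusSockets_uniform_of_lettersPerB9` at `𝔸 = M_N(ℂ)` (operator norm of [3] (19)), `τ = tr`, `H = SL(N, ℂ)`: the J-SU group data are the tree's
(`B8SpecialLinearTrace`: (H2) `tr log h = 0` on `SL(N)` near `1` for `N ≤ 25`, (H3), `SU(N) ≤ SL(N)`; `B7AvgClosedSpecialUnitarySharp.avgClosed_specialUnitary_of_le`: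
`SU(N)` averaging-closed for `N ≤ 25`; (G3) `e^{iλ} ∈ SU(N)` for Hermitian trace-free `λ`).  The shape consumed with
`B8Thm2TorusSupplier.thm2TorusAt_specialUnitary_of_sockets`.
[cite: Balaban1985RegularSpaces, Thm 2 p.83, p.76 («G = SU(N)»), §3 p.98; Balaban1985Averaging, p.20, (19)–(23) p.21; Balaban1985BackgroundPropagators, Thms 3.1–3.3 pp.397–399] -/
theorem thm2TorusSockets_specialUnitary_of_lettersPerB9 (hN : N ≤ 25) (hd2 : 2 ≤ d) {L : ℕ} (hL : 2 ≤ L)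
    {B₀ B₀' B₀'H B₂' BG BR B₀β cB9 β cL B₁ : ℝ} {len : Site d → ℝ}
    (hB₀ : 0 < B₀) (hB₀' : 0 < B₀') (hB : 2 ≤ 5 * (d : ℝ) * L * B₀) (hB₀'H : 0 < B₀'H) (hB₂' : 0 ≤ B₂') (hBG : 0 ≤ BG) (hBR : 0 ≤ BR)
    (hcB9 : 0 < cB9) (hcL : 0 < cL) (hfree : 3 * (2 * (d : ℝ) * (L : ℝ) ^ 2) * BG * (BR + 2) ≤ B₀')
    (hB₁ : 5 * (d : ℝ) * L * B₀ * (1 + 11 * (d : ℝ) ^ 2) ≤ B₁) :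
    letI : CStarAlgebra (Matrix (Fin N) (Fin N) ℂ) := {}
    ∃ cu c₀ : ℝ, 0 < cu ∧ 0 < c₀ ∧
      (∀ ⦃α₀ α₁ : ℝ⦄, 0 < α₀ → 0 < α₁ → α₀ + α₁ ≤ c₀ → Thm2TorusWindows d L B₀ (8 * B₀' * (5 * (d : ℝ) * L * B₀)) cu B₁ α₀ α₁) ∧
      ∀ (k : ℕ) (P : ℤ) (η : ℝ), 1 ≤ k → 0 < η → (∃ M : ℤ, P = (L : ℤ) ^ k * M) →
      ∀ ℓP : LettersAllPer (𝔸 := Matrix (Fin N) (Fin N) ℂ) L BG BR B₀'H B₂' B₀ B₀β cB9 β len cL η k P (specialUnitaryUnits (Fin N)),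
        LettersAllPerTau (𝔸 := Matrix (Fin N) (Fin N) ℂ) (trCLM (Fin N)) ℓP →
      ∀ ⦃α₀ α₁ : ℝ⦄, 0 < α₀ → 0 < α₁ → α₀ + α₁ ≤ c₀ → ∀ U₀ U' : Site d → Fin d → (Matrix (Fin N) (Fin N) ℂ)ˣ,
        (∀ x κ, U₀ x κ ∈ specialUnitaryUnits (Fin N)) → (∀ x κ, U' x κ ∈ specialUnitaryUnits (Fin N)) →
        (∀ i : Fin d, shiftCfg (P • e i) U₀ = U₀) → (∀ i : Fin d, shiftCfg (P • e i) U' = U') →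
        InAk L k η α₀ (fun _ => (Set.univ : Set (Site d))) U₀ → InAk L k η α₀ (fun _ => (Set.univ : Set (Site d))) (U' * U₀) →
        InAx L k (torusLam k) U₀ (U' * U₀) → Hyp135 L k (torusLam k) α₁ U₀ U' →
        Thm2TorusSockets L k P η 0 B₀ (2 * B₀) (8 * B₀' * (5 * (d : ℝ) * L * B₀)) cu B₁ len (specialUnitaryUnits (Fin N)) α₀ α₁ U₀ U' := by
  letI : CStarAlgebra (Matrix (Fin N) (Fin N) ℂ) := {}
  haveI : Nonempty (Fin N) := ⟨⟨0, Nat.pos_of_ne_zero (NeZero.ne N)⟩⟩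
  exact thm2TorusSockets_uniform_of_lettersPerB9 (trCLM (Fin N)) trCLM_mul_comm hd2 hL (H := slUnits N)
    (fun g hg hs => trCLM_mlog_eq_zero_of_mem_slUnits hN hg hs) (fun S hS => expUnit_mem_slUnits hS)
    (avgClosed_specialUnitary_of_le hN d L) specialUnitaryUnits_le_slUnits specialUnitaryUnits_le_unitaryUnits
    (fun lam x hsa htr => by rw [gaugeExp]; exact expUnit_I_smul_mem_specialUnitaryUnits hsa htr)
    hB₀ hB₀' hB hB₀'H hB₂' hBG hBR hcB9 hcL hfree hB₁

/-- ★ **THEOREM 2 ON THE TORUS FOR `G = SU(N)` (`1 ≤ N ≤ 25`), BOTH HALVES, MEMBER-UNIFORMLY, MODULO THE v3 LETTERS — THE v3 ENDPOINT OF SUB-ROW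
«G-B8-T2S» (RULING #4)**: `B8Thm2TorusAt.Thm2TorusAt L k P η 0 B₁ B₂ c₁ len (specialUnitaryUnits (Fin N)) (fun _ => True)` with ONE pair `B₂, c₁ > 0` at
every torus member (`k ≥ 1`, `P ∈ Lᵏℤ`, `η > 0`) carrying the v3 [4] letters `LettersAllPer … (specialUnitaryUnits (Fin N))` (laws at `P`-periodic arguments
only — what [4] Thms 3.1–3.3 print on `T_η`), their `tr`-laws — NOTHING ELSE — the input of `B8Thm2SetupTorus.thm2SetupSUAt_of_thm2TorusAt` (`N = 2`,
R3's P-V3-A row).  HONEST SCOPE: Theorem 2 on `T_η` for `SU(N)` MODULO THE v3 [4] LETTERS (displayed hypotheses; sub-row «G-B9-LETTERS» supplies them) and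
`B₁ > 5dLB₀(1 + 11d²)`, `5dLB₀ ≥ 2`, `3·(2dL²)·B_G·(B_R + 2) ≤ B₀′`; `β₀ = 0`; count-neutral — N05 ∕ `stub_PV3A` NOT discharged (its consumer owes the
letters); nothing continuum ∕ ℝ⁴ ∕ OS ∕ mass-gap ∕ Clay: the Yang–Mills mass gap is NOT proved.
[cite: Balaban1985RegularSpaces, Thm 2 p.83, (1.33)–(1.39) pp.82–83, p.76 («G = SU(N)»), p.77 («Ω_j = T_η»), Thm 4 p.88, Prop. 5 p.94, p.95, §3 p.98; Balaban1985Averaging, p.20; Balaban1985BackgroundPropagators, Thms 3.1–3.3 pp.397–399] -/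
theorem thm2TorusAt_specialUnitary_of_lettersPerB9 (hN : N ≤ 25) (hd2 : 2 ≤ d) {L : ℕ} (hL : 2 ≤ L)
    {B₀ B₀' B₀'H B₂' BG BR B₀β cB9 β cL B₁ : ℝ} {len : Site d → ℝ}
    (hB₀ : 0 < B₀) (hB₀' : 0 < B₀') (hB : 2 ≤ 5 * (d : ℝ) * L * B₀) (hB₀'H : 0 < B₀'H) (hB₂' : 0 ≤ B₂') (hBG : 0 ≤ BG) (hBR : 0 ≤ BR)
    (hcB9 : 0 < cB9) (hcL : 0 < cL) (hfree : 3 * (2 * (d : ℝ) * (L : ℝ) ^ 2) * BG * (BR + 2) ≤ B₀')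
    (hB₁ : 5 * (d : ℝ) * L * B₀ * (1 + 11 * (d : ℝ) ^ 2) < B₁) :
    letI : CStarAlgebra (Matrix (Fin N) (Fin N) ℂ) := {}
    ∃ B₂ c₁ : ℝ, 0 < B₂ ∧ 0 < c₁ ∧ ∀ (k : ℕ) (P : ℤ) (η : ℝ), 1 ≤ k → 0 < η → (∃ M : ℤ, P = (L : ℤ) ^ k * M) →
      ∀ ℓP : LettersAllPer (𝔸 := Matrix (Fin N) (Fin N) ℂ) L BG BR B₀'H B₂' B₀ B₀β cB9 β len cL η k P (specialUnitaryUnits (Fin N)),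
        LettersAllPerTau (𝔸 := Matrix (Fin N) (Fin N) ℂ) (trCLM (Fin N)) ℓP →
      Thm2TorusAt L k P η 0 B₁ B₂ c₁ len (specialUnitaryUnits (Fin N)) (fun _ => True) := by
  letI : CStarAlgebra (Matrix (Fin N) (Fin N) ℂ) := {}
  haveI : Nonempty (Fin N) := ⟨⟨0, Nat.pos_of_ne_zero (NeZero.ne N)⟩⟩
  exact thm2TorusAt_uniform_of_lettersPerB9 (trCLM (Fin N)) trCLM_mul_comm hd2 hL (H := slUnits N)
    (fun g hg hs => trCLM_mlog_eq_zero_of_mem_slUnits hN hg hs) (fun S hS => expUnit_mem_slUnits hS)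
    (avgClosed_specialUnitary_of_le hN d L) specialUnitaryUnits_le_slUnits specialUnitaryUnits_le_unitaryUnits
    (fun lam x hsa htr => by rw [gaugeExp]; exact expUnit_I_smul_mem_specialUnitaryUnits hsa htr)
    hB₀ hB₀' hB hB₀'H hB₂' hBG hBR hcB9 hcL hfree hB₁

end SpecialUnitary


end Literature.MathematicalPhysics.QuantumFieldTheory.Balaban1983to89.B8Thm2TorusAtOfLettersPerB9

end
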